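import Mathlib
import Literature.Combinatorics.Additive.TripleProductProperty
import Literature.Computability.Complexity.CNFRelabel
import Literature.Computability.Complexity.LRATImport
import Summits.MatrixMultiplication.MatrixMultiplication.Theorems.HyperoctahedralThreshold.Negative.HostedTPPSATTransfer

/-!
# Cell (cube-and-conquer) form of the hosted-TPP volume certificates

When one UNSAT certificate for `HostData.certCNF D P V` is too large to import, the size region
"volume `> V`, pair bounds `P`" is covered by finitely many *cells* `t ≤ (|X 0|, |X 1|, |X 2|) ≤ hi`
(componentwise), each refuted separately: `HostData.cellCNF D P V t hi` is `rawCNF` under the cube of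
unit size literals of the cell (`CNF.withCube`, then the same variable numbering), so its DIMACS is the
monolithic one with a few unit clauses in front, and each cell has its own (small) LRAT refutation.
`HostData.domCheck` is the decidable cover condition; `HostData.volume_le_of_cells_centralizer` is the
transfer theorem: cover + all cells UNSAT ⇒ every hosted TPP triple has volume `≤ V`.

References: M. Heule, O. Kullmann, S. Wieringa, A. Biere, *Cube and conquer*, HVC 2011, §3;
C. Sinz, CP 2005, §2; H. Cohn, C. Umans, FOCS 2003, Def. 2.1.
-/

namespace Summit.MatrixMultiplication.MatrixMultiplication.Theorems.HyperoctahedralThreshold.Negative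

set_option linter.dupNamespace false

open Literature.Computability.Complexity Literature.Combinatorics.Additive

namespace HostData

variable {G : Type*} [Group G] [DecidableEq G] {N : ℕ} (D : HostData G N)

/-- Lower-bound literal(s) "`|X i| ≥ a`" (none for `a = 0`; an unsatisfiable one for `a > N`).
[cite: HeuleKullmannWieringaBiere2012, §3] -/
def loLits (N : ℕ) (i : Fin 3) (a : ℕ) : List (Literal (HVar N)) :=
  if h : a < N + 1 then (if a = 0 then [] else [pos N (S i ⟨a, h⟩)]) else [neg N (S i 0)]

/-- Upper-bound literal "`|X i| ≤ b`" (none if `b ≥ N`). [cite: HeuleKullmannWieringaBiere2012, §3] -/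
def hiLits (N : ℕ) (i : Fin 3) (b : ℕ) : List (Literal (HVar N)) :=
  if h : b + 1 < N + 1 then [neg N (S i ⟨b + 1, h⟩)] else []

/-- The cube of a cell `t ≤ sizes ≤ hi`. [cite: HeuleKullmannWieringaBiere2012, §3] -/
def cellCube (N : ℕ) (t hi : ℕ × ℕ × ℕ) : List (Literal (HVar N)) :=
  (loLits N 0 t.1 ++ loLits N 1 t.2.1 ++ loLits N 2 t.2.2) ++
    (hiLits N 0 hi.1 ++ hiLits N 1 hi.2.1 ++ hiLits N 2 hi.2.2)

/-- **The cell CNF** over `ℕ`: `rawCNF` under the cell's cube, numbered by `HVar.code` (so its DIMACS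
is that of `certCNF` with the cube's unit clauses in front). [cite: HeuleKullmannWieringaBiere2012, §3] -/
def cellCNF (P : Fin 3 × Fin 3 → ℕ) (V : ℕ) (t hi : ℕ × ℕ × ℕ) : CNF ℕ :=
  ((D.rawCNF P V).withCube (cellCube N t hi)).relabel HVar.code

/-- Componentwise order on size triples (Boolean). [folklore] -/
def le3 (x y : ℕ × ℕ × ℕ) : Bool :=
  decide (x.1 ≤ y.1) && decide (x.2.1 ≤ y.2.1) && decide (x.2.2 ≤ y.2.2)

/-- **Cover check**: every size triple `(a, b, c) ≤ N` of volume `> V` within the pair bounds `P`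
lies in some cell of `L`. [cite: HeuleKullmannWieringaBiere2012, §3] -/
def domCheck (N : ℕ) (P : Fin 3 × Fin 3 → ℕ) (V : ℕ) (L : List ((ℕ × ℕ × ℕ) × (ℕ × ℕ × ℕ))) : Bool :=
  (List.range (N + 1)).all fun a => (List.range (N + 1)).all fun b => (List.range (N + 1)).all fun c =>
    !(decide (V < a * b * c) && decide (a * b ≤ P (0, 1)) && decide (b * c ≤ P (1, 2)) &&
        decide (c * a ≤ P (2, 0))) ||
      L.any fun th => le3 th.1 (a, b, c) && le3 (a, b, c) th.2

/-- Meaning of `le3`. [folklore] -/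
theorem le3_iff (x y : ℕ × ℕ × ℕ) : le3 x y = true ↔ x.1 ≤ y.1 ∧ x.2.1 ≤ y.2.1 ∧ x.2.2 ≤ y.2.2 := by
  simp [le3, Bool.and_eq_true, decide_eq_true_eq, and_assoc]

/-- Meaning of `domCheck`. [folklore] -/
theorem domCheck_spec {N : ℕ} {P : Fin 3 × Fin 3 → ℕ} {V : ℕ} {L : List ((ℕ × ℕ × ℕ) × (ℕ × ℕ × ℕ))}
    (h : domCheck N P V L = true) {a b c : ℕ} (ha : a ≤ N) (hb : b ≤ N) (hc : c ≤ N)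
    (hvol : V < a * b * c) (h01 : a * b ≤ P (0, 1)) (h12 : b * c ≤ P (1, 2)) (h20 : c * a ≤ P (2, 0)) :
    ∃ th ∈ L, le3 th.1 (a, b, c) = true ∧ le3 (a, b, c) th.2 = true := by
  simp only [domCheck, List.all_eq_true, List.mem_range] at h
  have := h a (by omega) b (by omega) c (by omega)
  simp only [Bool.or_eq_true, Bool.not_eq_true', Bool.and_eq_false_iff, decide_eq_false_iff_not,
    List.any_eq_true, Bool.and_eq_true] at this
  rcases this with hneg | ⟨th, hth, h1, h2⟩
  · exfalso
    rcases hneg with ((hv | h1) | h2) | h3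
    · exact hv hvol
    · exact h1 h01
    · exact h2 h12
    · exact h3 h20
  · exact ⟨th, hth, h1, h2⟩

section completeness

variable {D}
variable (hinj : ∀ i, Function.Injective (D.E i)) (hone : ∀ i, D.E i (D.one i) = 1)
variable {P : Fin 3 × Fin 3 → ℕ} {V : ℕ} {I : Fin 3 → Finset (Fin N)}

/-- Lower-bound literals hold when the bound holds. [folklore] -/
theorem loLits_hold (i : Fin 3) {a : ℕ} (ha : a ≤ (I i).card) :
    ∀ l ∈ loLits N i a, Literal.eval (D.assignment I) l = true := by
  intro l hl
  have hN : (I i).card ≤ N := by simpa only [Fintype.card_fin] using Finset.card_le_univ (I i)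
  unfold loLits at hl
  rw [dif_pos (by omega)] at hl
  split_ifs at hl with h0
  · simp at hl
  · simp only [List.mem_singleton] at hl; subst hl
    rw [eval_pos, assignment_S]; simpa using ha

/-- Upper-bound literals hold when the bound holds. [folklore] -/
theorem hiLits_hold (i : Fin 3) {b : ℕ} (hb : (I i).card ≤ b) :
    ∀ l ∈ hiLits N i b, Literal.eval (D.assignment I) l = true := by
  intro l hl
  unfold hiLits at hl
  split_ifs at hl with h
  · simp only [List.mem_singleton] at hl; subst hl
    rw [eval_neg, assignment_S]; simp only [decide_eq_false_iff_not]; omega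
  · simp at hl

include hinj hone in
/-- **Completeness of the cell CNF**: the canonical assignment of an index triple in the cell
(identities, index-TPP, pair bounds, volume `> V`, `t ≤ sizes ≤ hi`) satisfies `cellCNF`.
[cite: HeuleKullmannWieringaBiere2012, §3] -/
theorem cellCNF_satisfiable_of_triple (hI1 : ∀ i, D.one i ∈ I i) (htpp : D.IndexTPP I)
    (hpp : ∀ ij ∈ pairs, (I ij.1).card * (I ij.2).card ≤ P ij)
    (hvol : V < (I 0).card * (I 1).card * (I 2).card) {t hi : ℕ × ℕ × ℕ}
    (hlo : le3 t ((I 0).card, (I 1).card, (I 2).card) = true)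
    (hhi : le3 ((I 0).card, (I 1).card, (I 2).card) hi = true) :
    (D.cellCNF P V t hi).Satisfiable := by
  rw [cellCNF, CNF.satisfiable_relabel_iff HVar.code_injective]
  refine ⟨D.assignment I, (CNF.eval_withCube_eq_true_iff _ _ _).2 ⟨?_, ?_⟩⟩
  · rw [le3_iff] at hlo hhi
    obtain ⟨l0, l1, l2⟩ := hlo
    obtain ⟨u0, u1, u2⟩ := hhi
    intro l hl
    simp only [cellCube, List.mem_append] at hl
    rcases hl with ((hl | hl) | hl) | ((hl | hl) | hl)
    · exact loLits_hold 0 l0 l hl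
    · exact loLits_hold 1 l1 l hl
    · exact loLits_hold 2 l2 l hl
    · exact hiLits_hold 0 u0 l hl
    · exact hiLits_hold 1 u1 l hl
    · exact hiLits_hold 2 u2 l hl
  · refine (CNF.eval_eq_true_iff _ _).2 fun c hc => ?_
    have h0 : 0 < (I 0).card := Finset.card_pos.2 ⟨_, hI1 0⟩
    have h1 : 0 < (I 1).card := Finset.card_pos.2 ⟨_, hI1 1⟩
    have h2 : (I 2).card ≤ N := by
      simpa only [Fintype.card_fin] using Finset.card_le_univ (I 2)
    simp only [rawCNF, List.mem_append] at hc
    rcases hc with (((hc | hc) | hc) | hc) | hc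
    · exact quotClauses_hold hinj hone hI1 c hc
    · exact tppClauses_hold htpp c hc
    · exact counterClauses_hold c hc
    · exact ppClauses_hold hpp c hc
    · exact volClauses_hold h0 h1 h2 hvol c hc

end completeness

/-- **From cell UNSATs to the volume bound.** If the cells `L` cover the region (`domCheck`), every
`cellCNF D (pairBounds D) V t hi`, `(t, hi) ∈ L`, is unsatisfiable, the enumerations are injective with
`E i (one i) = 1`, and host `i` is closed under `x y⁻¹`, then every TPP triple `X i ⊆ host i` with
`1 ∈ X i` has volume `≤ V`. [cite: HeuleKullmannWieringaBiere2012, §3] -/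
theorem volume_le_of_cells (hinj : ∀ i, Function.Injective (D.E i))
    (hone : ∀ i, D.E i (D.one i) = 1) (hcl : ∀ i a b, ∃ c, D.E i c = D.E i a * (D.E i b)⁻¹)
    {V : ℕ} (L : List ((ℕ × ℕ × ℕ) × (ℕ × ℕ × ℕ))) (hdom : domCheck N D.pairBounds V L = true)
    (hcells : ∀ th ∈ L, ¬ (D.cellCNF D.pairBounds V th.1 th.2).Satisfiable)
    (X : Fin 3 → Finset G) (hX : ∀ i, ∀ x ∈ X i, ∃ a, D.E i a = x) (hX1 : ∀ i, (1 : G) ∈ X i)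
    (htpp : TripleProductProperty (X 0) (X 1) (X 2)) :
    (X 0).card * (X 1).card * (X 2).card ≤ V := by
  classical
  by_contra hlt
  push Not at hlt
  -- index sets (as in `volume_le_of_unsat`)
  let I : Fin 3 → Finset (Fin N) := fun i => Finset.univ.filter fun a => D.E i a ∈ X i
  have hIX : ∀ i, (I i).image (D.E i) = X i := by
    intro i; ext x
    simp only [Finset.mem_image, Finset.mem_filter, Finset.mem_univ, true_and, I]
    constructor
    · rintro ⟨a, ha, rfl⟩; exact ha
    · intro hx; obtain ⟨a, rfl⟩ := hX i x hx; exact ⟨a, hx, rfl⟩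
  have hcard : ∀ i, (I i).card = (X i).card := fun i => by
    rw [← hIX i, Finset.card_image_of_injective _ (hinj i)]
  have hI1 : ∀ i, D.one i ∈ I i := fun i => by
    simp only [Finset.mem_filter, Finset.mem_univ, true_and, I, hone]; exact hX1 i
  have hItpp : D.IndexTPP I := by
    intro t ht ⟨h0, h1, h2⟩
    obtain ⟨hprod, hne⟩ := D.mem_bad ht
    simp only [Qidx, Finset.mem_image₂] at h0 h1 h2
    obtain ⟨a, ha, a', ha', hq0⟩ := h0
    obtain ⟨b, hb, b', hb', hq1⟩ := h1
    obtain ⟨c, hc, c', hc', hq2⟩ := h2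
    simp only [Finset.mem_filter, Finset.mem_univ, true_and, I] at ha ha' hb hb' hc hc'
    have e0 := D.E_q hcl 0 a a'; have e1 := D.E_q hcl 1 b b'; have e2 := D.E_q hcl 2 c c'
    rw [hq0] at e0; rw [hq1] at e1; rw [hq2] at e2
    have key : D.E 0 a * (D.E 0 a')⁻¹ * (D.E 1 b * (D.E 1 b')⁻¹) * (D.E 2 c * (D.E 2 c')⁻¹) = 1 := by
      rw [← e0, ← e1, ← e2]; exact hprod
    obtain ⟨r0, r1, r2⟩ := htpp _ ha _ ha' _ hb _ hb' _ hc _ hc' key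
    apply hne
    refine ⟨hinj 0 ?_, hinj 1 ?_, hinj 2 ?_⟩
    · rw [e0, r0, mul_inv_cancel, hone]
    · rw [e1, r1, mul_inv_cancel, hone]
    · rw [e2, r2, mul_inv_cancel, hone]
  have hne : ∀ i, (X i).Nonempty := fun i => ⟨1, hX1 i⟩
  have p01 : (X 0).card * (X 1).card ≤ D.pairBounds (0, 1) :=
    D.card_mul_card_le_pairCount htpp (hne 2) (hX 0) (hX 1)
  have p12 : (X 1).card * (X 2).card ≤ D.pairBounds (1, 2) :=
    D.card_mul_card_le_pairCount (tpp_rotate htpp) (hne 0) (hX 1) (hX 2)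
  have p20 : (X 2).card * (X 0).card ≤ D.pairBounds (2, 0) :=
    D.card_mul_card_le_pairCount (tpp_rotate (tpp_rotate htpp)) (hne 1) (hX 2) (hX 0)
  have hpp : ∀ ij ∈ pairs, (I ij.1).card * (I ij.2).card ≤ D.pairBounds ij := by
    intro ij hij
    simp only [pairs, List.mem_cons, List.not_mem_nil, or_false] at hij
    rcases hij with rfl | rfl | rfl <;> simp only [hcard]
    · exact p01
    · exact p12
    · exact p20
  have hN : ∀ i, (X i).card ≤ N := fun i => by
    rw [← hcard]; simpa only [Fintype.card_fin] using Finset.card_le_univ (I i)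
  obtain ⟨th, hth, hlo, hhi⟩ := domCheck_spec hdom (hN 0) (hN 1) (hN 2) hlt p01 p12 p20
  refine hcells th hth (D.cellCNF_satisfiable_of_triple hinj hone hI1 hItpp hpp ?_ ?_ ?_)
  · simpa only [hcard] using hlt
  · simpa only [hcard] using hlo
  · simpa only [hcard] using hhi

/-- **Volume bound for TPP triples inside three centralisers, from cell certificates** (the cell form
of `volume_le_of_unsat_centralizer`). [cite: HeuleKullmannWieringaBiere2012, §3] -/
theorem volume_le_of_cells_centralizer (μ : Fin 3 → G)
    (hhost : ∀ i σ, σ * μ i = μ i * σ ↔ ∃ a, D.E i a = σ)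
    (hinj : ∀ i, Function.Injective (D.E i)) (hone : ∀ i, D.E i (D.one i) = 1)
    {V : ℕ} (L : List ((ℕ × ℕ × ℕ) × (ℕ × ℕ × ℕ))) (hdom : domCheck N D.pairBounds V L = true)
    (hcells : ∀ th ∈ L, ¬ (D.cellCNF D.pairBounds V th.1 th.2).Satisfiable)
    (X : Fin 3 → Finset G) (hX : ∀ i, ∀ σ ∈ X i, σ * μ i = μ i * σ)
    (htpp : TripleProductProperty (X 0) (X 1) (X 2)) :
    (X 0).card * (X 1).card * (X 2).card ≤ V := by
  classical
  by_cases hne : ∀ i, (X i).Nonempty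
  swap
  · push Not at hne
    obtain ⟨i, hi⟩ := hne
    have h0 : (X i).card = 0 := Finset.card_eq_zero.2 hi
    have hprod : (X 0).card * (X 1).card * (X 2).card = ∏ j : Fin 3, (X j).card :=
      (Fin.prod_univ_three (fun j => (X j).card)).symm
    rw [hprod, Finset.prod_eq_zero (Finset.mem_univ i) h0]
    exact Nat.zero_le _
  choose s hs using hne
  let Y : Fin 3 → Finset G := fun i => (X i).image (· * (s i)⁻¹)
  have hcomm : ∀ i (x y : G), x * μ i = μ i * x → y * μ i = μ i * y →
      x * y⁻¹ * μ i = μ i * (x * y⁻¹) := by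
    intro i x y hx hy
    have hy' : y⁻¹ * μ i = μ i * y⁻¹ := by
      calc y⁻¹ * μ i = y⁻¹ * (μ i * y) * y⁻¹ := by group
        _ = y⁻¹ * (y * μ i) * y⁻¹ := by rw [hy]
        _ = μ i * y⁻¹ := by group
    calc x * y⁻¹ * μ i = x * (y⁻¹ * μ i) := by group
      _ = x * (μ i * y⁻¹) := by rw [hy']
      _ = (x * μ i) * y⁻¹ := by group
      _ = (μ i * x) * y⁻¹ := by rw [hx]
      _ = μ i * (x * y⁻¹) := by group
  have hY : ∀ i, ∀ y ∈ Y i, ∃ a, D.E i a = y := by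
    intro i y hy
    simp only [Finset.mem_image, Y] at hy
    obtain ⟨x, hx, rfl⟩ := hy
    exact (hhost i _).1 (hcomm i x (s i) (hX i x hx) (hX i _ (hs i)))
  have hY1 : ∀ i, (1 : G) ∈ Y i := fun i =>
    Finset.mem_image.2 ⟨s i, hs i, mul_inv_cancel (s i)⟩
  have hcard : ∀ i, (Y i).card = (X i).card := fun i =>
    Finset.card_image_of_injective _ (mul_left_injective ((s i)⁻¹))
  have hcl : ∀ i a b, ∃ c, D.E i c = D.E i a * (D.E i b)⁻¹ := fun i a b =>
    (hhost i _).1 (hcomm i _ _ ((hhost i _).2 ⟨a, rfl⟩) ((hhost i _).2 ⟨b, rfl⟩))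
  have hYtpp : TripleProductProperty (Y 0) (Y 1) (Y 2) := tpp_image_mul_right htpp _ _ _
  have := D.volume_le_of_cells hinj hone hcl L hdom hcells Y hY hY1 hYtpp
  simpa only [hcard] using this

end HostData

end Summit.MatrixMultiplication.MatrixMultiplication.Theorems.HyperoctahedralThreshold.Negative
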